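import Summits.NavierStokesRegularity.FluidComputer.PalasekTowerGermHostFarField

/-!
# The germ host, VIII: the third derivative of the Newtonian kernel and its SIGN ON CONES

Cell `ns-blowup`, seat `ns-blowup-ecbridge-3` (g3); GROUP C «BRIDGE SUPPORT» of the route
`PalasekTowerBreakdown` (crux `EpisodeBaseG`, item stmt-NavierStokesRegularity-19179, R2 of record).
LABEL: E–C typing (KERNEL calculus: one definition — the third radial profile — and identities /
inequalities). WHAT THIS IS NOT: not Navier–Stokes evidence — pointwise calculus of `Γ = −1/(4π|z|)`.

## What and why

`PalasekTowerGermHostFarField.anchor_test_iff_integral` (p448542) writes the strict anchor test of a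
symmetric composite design as `−ν⟪U₁(x₀), ΔU₁(x₀)⟫ < ∫ ∂ₑΓ(x₀ − x) · div((U₂·∇)U₂)(x) dx`,
`e = U₁(x₀)`. Since `div((U₂·∇)U₂) = ∂ᵢ∂ⱼ((U₂)ᵢ(U₂)ⱼ)`, two integrations by parts over the far
structures turn the right-hand side into `∫ D³Γ(x₀ − x)(U₂(x), U₂(x), e) dx` — a quadratic form in
`U₂(x)` with the explicit kernel of this file:

* §1 `newtonProfile₃` (`γ‴`) and **`fderiv3_newtonKernel_apply`**:
  `D³Γ(z)(a, b, c) = [15⟨z,a⟩⟨z,b⟩⟨z,c⟩ − 3|z|²(⟨a,b⟩⟨z,c⟩ + ⟨a,c⟩⟨z,b⟩ + ⟨b,c⟩⟨z,a⟩)] / (4π|z|⁷)`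
  (Gilbarg–Trudinger (2.13) differentiated once more);
* §2 **the cone sign**: for a direction `d ⊥ e`,
  `D³Γ(z)(d, d, e) = ⟨z, e⟩ (15⟨z,d⟩² − 3|z|²|d|²) / (4π|z|⁷)`, which is POSITIVE when `⟨z, e⟩ < 0`
  and `5⟨z, d⟩² < |z|²|d|²` (`z` within `arccos(1/√5) ≈ 63°` of the axis `∓e` as seen from `d`), and
  NEGATIVE when `⟨z, e⟩ > 0` under the same cone condition (`fderiv3_newtonKernel_dde_pos/neg`).

Reading for the design (HEUR until the two integrations by parts are formalised): a far structure
`U₂` whose velocities are everywhere ORTHOGONAL to `e = U₁(x₀)/Y₀` (e.g. a horizontal swirl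
`(∂₂ψ, −∂₁ψ, 0)`), placed in a narrow cone AHEAD of `x₀` along `e` (`z = x₀ − x` with `⟨z, e⟩ < 0`),
makes the integrand positive pointwise, hence passes the strict test once its (positive) size beats the
carrier's viscous braking; placed BEHIND `x₀` it fails pointwise.

References: D. Gilbarg, N. S. Trudinger, *Elliptic PDE of Second Order* (2001), (2.12)–(2.13)
[cite: GilbargTrudinger2001, (2.13)].
-/

noncomputable section

namespace Summit.NavierStokesRegularity.FluidComputer.PalasekTowerClayBridge.Germ

open Set Function Filter Topology InnerProductSpace Real
open scoped Topology RealInnerProductSpace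

open Literature.Analysis.FluidPDE

-- nested operator types `ℝ³ →L[ℝ] ℝ³ →L[ℝ] ℝ` (second derivatives)
set_option maxSynthPendingDepth 3

/-! ## §1 The third derivative of `Γ` -/

/-- `γ‴(σ) = (15/(32π)) σ^{-7/2}` — the third radial profile of the Newtonian kernel
(`Γ(z) = γ(|z|²)`). [folklore] -/
def newtonProfile₃ (σ : ℝ) : ℝ := (15 / (32 * π)) * σ ^ (-(7 / 2 : ℝ))

/-- `γ″' = γ‴` on `σ > 0`. [folklore] -/
theorem hasDerivAt_newtonProfile₂ {σ : ℝ} (hσ : 0 < σ) :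
    HasDerivAt newtonProfile₂ (newtonProfile₃ σ) σ := by
  have h : HasDerivAt newtonProfile₂
      (-(3 / (16 * π)) * (-(5 / 2 : ℝ) * σ ^ (-(5 / 2 : ℝ) - 1))) σ :=
    (Real.hasDerivAt_rpow_const (p := -(5 / 2 : ℝ)) (Or.inl hσ.ne')).const_mul (-(3 / (16 * π)))
  refine h.congr_deriv ?_
  rw [newtonProfile₃, show (-(5 / 2 : ℝ)) - 1 = -(7 / 2 : ℝ) by norm_num]
  field_simp
  ring

/-- The derivative of `w ↦ ⟨w, a⟩` is `⟨a, ·⟩`. [folklore] -/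
theorem hasFDerivAt_inner_left_const (a z : EuclideanSpace ℝ (Fin 3)) :
    HasFDerivAt (fun w : EuclideanSpace ℝ (Fin 3) => ⟪w, a⟫)
      (innerSL ℝ a : EuclideanSpace ℝ (Fin 3) →L[ℝ] ℝ) z := by
  have h : (fun w : EuclideanSpace ℝ (Fin 3) => ⟪w, a⟫) = fun w => (innerSL ℝ a) w := by
    funext w; rw [innerSL_apply_apply, real_inner_comm]
  rw [h]
  exact (innerSL ℝ a).hasFDerivAt

/-- **Off the origin the second derivative of `Γ` is the explicit radial expression**
`D²Γ(w)(a, b) = 4γ″(|w|²)⟨w,a⟩⟨w,b⟩ + 2γ′(|w|²)⟨a,b⟩`, locally around any `z ≠ 0`. [folklore] -/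
theorem fderiv_fderiv_newtonKernel_eventuallyEq {z : EuclideanSpace ℝ (Fin 3)} (hz : z ≠ 0)
    (a b : EuclideanSpace ℝ (Fin 3)) :
    (fun w => fderiv ℝ (fun w' => fderiv ℝ newtonKernel w' a) w b) =ᶠ[𝓝 z]
      fun w => 4 * newtonProfile₂ (‖w‖ ^ 2) * ⟪w, a⟫ * ⟪w, b⟫ +
        2 * newtonProfile₁ (‖w‖ ^ 2) * ⟪a, b⟫ := by
  filter_upwards [isOpen_compl_singleton.mem_nhds hz] with w hw
  have hw0 : w ≠ 0 := hw
  have hσ : ‖w‖ ^ 2 ∈ Ioi (0 : ℝ) := by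
    show 0 < ‖w‖ ^ 2
    positivity
  exact fderiv_fderiv_comp_norm_sq_apply (E := EuclideanSpace ℝ (Fin 3)) (g := newtonProfile)
    (g₁ := newtonProfile₁) isOpen_Ioi (fun σ hσ => hasDerivAt_newtonProfile hσ) hσ
    (hasDerivAt_newtonProfile₁ hσ) a b

/-- **THE THIRD DERIVATIVE OF THE NEWTONIAN KERNEL**:
`D³Γ(z)(a, b, c) = [15⟨z,a⟩⟨z,b⟩⟨z,c⟩ − 3|z|²(⟨a,b⟩⟨z,c⟩ + ⟨a,c⟩⟨z,b⟩ + ⟨b,c⟩⟨z,a⟩)] / (4π|z|⁷)`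
for `z ≠ 0`. [cite: GilbargTrudinger2001, (2.13)] -/
theorem fderiv3_newtonKernel_apply {z : EuclideanSpace ℝ (Fin 3)} (hz : z ≠ 0)
    (a b c : EuclideanSpace ℝ (Fin 3)) :
    fderiv ℝ (fun w => fderiv ℝ (fun w' => fderiv ℝ newtonKernel w' a) w b) z c =
      (15 * ⟪z, a⟫ * ⟪z, b⟫ * ⟪z, c⟫ -
          3 * ‖z‖ ^ 2 * (⟪a, b⟫ * ⟪z, c⟫ + ⟪a, c⟫ * ⟪z, b⟫ + ⟪b, c⟫ * ⟪z, a⟫)) /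
        (4 * π * ‖z‖ ^ 7) := by
  have hσ : 0 < ‖z‖ ^ 2 := by positivity
  rw [(fderiv_fderiv_newtonKernel_eventuallyEq hz a b).fderiv_eq]
  -- differentiate the explicit expression
  have h1 : HasFDerivAt (fun w : EuclideanSpace ℝ (Fin 3) => newtonProfile₂ (‖w‖ ^ 2))
      ((2 * newtonProfile₃ (‖z‖ ^ 2)) • (innerSL ℝ z : EuclideanSpace ℝ (Fin 3) →L[ℝ] ℝ)) z :=
    hasFDerivAt_comp_norm_sq (hasDerivAt_newtonProfile₂ hσ)
  have h2 : HasFDerivAt (fun w : EuclideanSpace ℝ (Fin 3) => newtonProfile₁ (‖w‖ ^ 2))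
      ((2 * newtonProfile₂ (‖z‖ ^ 2)) • (innerSL ℝ z : EuclideanSpace ℝ (Fin 3) →L[ℝ] ℝ)) z :=
    hasFDerivAt_comp_norm_sq (hasDerivAt_newtonProfile₁ hσ)
  have ha := hasFDerivAt_inner_left_const a z
  have hb := hasFDerivAt_inner_left_const b z
  have h := ((((h1.const_mul 4).mul ha).mul hb)).add ((h2.const_mul 2).mul_const ⟪a, b⟫)
  have hfun : (fun w : EuclideanSpace ℝ (Fin 3) =>
      4 * newtonProfile₂ (‖w‖ ^ 2) * ⟪w, a⟫ * ⟪w, b⟫ + 2 * newtonProfile₁ (‖w‖ ^ 2) * ⟪a, b⟫) =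
      ((((fun y : EuclideanSpace ℝ (Fin 3) => 4 * newtonProfile₂ (‖y‖ ^ 2)) *
        fun w => ⟪w, a⟫) * fun w => ⟪w, b⟫) +
        fun y => 2 * newtonProfile₁ (‖y‖ ^ 2) * ⟪a, b⟫) := by
    funext w; simp only [Pi.add_apply, Pi.mul_apply]
  rw [hfun, h.fderiv]
  simp only [add_apply, smul_apply, smul_eq_mul, innerSL_apply_apply, Pi.mul_apply]
  rw [newtonProfile₃, newtonProfile₂, norm_sq_rpow, norm_sq_rpow,
    show (2 : ℝ) * -(7 / 2) = -7 by norm_num, show (2 : ℝ) * -(5 / 2) = -5 by norm_num,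
    Real.rpow_neg (norm_nonneg z), Real.rpow_neg (norm_nonneg z),
    show (7 : ℝ) = ((7 : ℕ) : ℝ) by norm_num, show (5 : ℝ) = ((5 : ℕ) : ℝ) by norm_num,
    Real.rpow_natCast, Real.rpow_natCast]
  have : ‖z‖ ≠ 0 := norm_ne_zero_iff.2 hz
  field_simp
  ring

/-! ## §2 The sign of `D³Γ(z)(d, d, e)` on cones -/

/-- For `d ⊥ e`: `D³Γ(z)(d, d, e) = ⟨z, e⟩ (15⟨z,d⟩² − 3|z|²|d|²) / (4π|z|⁷)`. [folklore] -/
theorem fderiv3_newtonKernel_dde {z : EuclideanSpace ℝ (Fin 3)} (hz : z ≠ 0)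
    {d e : EuclideanSpace ℝ (Fin 3)} (hde : ⟪d, e⟫ = 0) :
    fderiv ℝ (fun w => fderiv ℝ (fun w' => fderiv ℝ newtonKernel w' d) w d) z e =
      ⟪z, e⟫ * (15 * ⟪z, d⟫ ^ 2 - 3 * ‖z‖ ^ 2 * ‖d‖ ^ 2) / (4 * π * ‖z‖ ^ 7) := by
  rw [fderiv3_newtonKernel_apply hz, real_inner_self_eq_norm_sq, hde]
  ring

/-- **POSITIVE on the forward cone**: if `d ⊥ e`, `⟨z, e⟩ < 0` and `5⟨z, d⟩² < |z|²|d|²` then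
`D³Γ(z)(d, d, e) > 0`. (With `z = x₀ − x`: the far structure sits AHEAD of `x₀` along `e`, with
velocities orthogonal to `e`, inside the cone.) [folklore] -/
theorem fderiv3_newtonKernel_dde_pos {z d e : EuclideanSpace ℝ (Fin 3)} (hde : ⟪d, e⟫ = 0)
    (hze : ⟪z, e⟫ < 0) (hcone : 5 * ⟪z, d⟫ ^ 2 < ‖z‖ ^ 2 * ‖d‖ ^ 2) :
    0 < fderiv ℝ (fun w => fderiv ℝ (fun w' => fderiv ℝ newtonKernel w' d) w d) z e := by
  have hz : z ≠ 0 := by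
    intro h
    rw [h, norm_zero] at hcone
    nlinarith [sq_nonneg ⟪(0 : EuclideanSpace ℝ (Fin 3)), d⟫]
  have hzn : 0 < ‖z‖ := norm_pos_iff.2 hz
  rw [fderiv3_newtonKernel_dde hz hde]
  have hneg : 15 * ⟪z, d⟫ ^ 2 - 3 * ‖z‖ ^ 2 * ‖d‖ ^ 2 < 0 := by linarith
  have hnum : 0 < ⟪z, e⟫ * (15 * ⟪z, d⟫ ^ 2 - 3 * ‖z‖ ^ 2 * ‖d‖ ^ 2) := mul_pos_of_neg_of_neg hze hneg
  positivity

/-- **NEGATIVE on the backward cone**: if `d ⊥ e`, `⟨z, e⟩ > 0` and `5⟨z, d⟩² < |z|²|d|²` then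
`D³Γ(z)(d, d, e) < 0` (the far structure BEHIND `x₀` brakes). [folklore] -/
theorem fderiv3_newtonKernel_dde_neg {z d e : EuclideanSpace ℝ (Fin 3)} (hde : ⟪d, e⟫ = 0)
    (hze : 0 < ⟪z, e⟫) (hcone : 5 * ⟪z, d⟫ ^ 2 < ‖z‖ ^ 2 * ‖d‖ ^ 2) :
    fderiv ℝ (fun w => fderiv ℝ (fun w' => fderiv ℝ newtonKernel w' d) w d) z e < 0 := by
  have hz : z ≠ 0 := by
    intro h
    rw [h, norm_zero] at hcone
    nlinarith [sq_nonneg ⟪(0 : EuclideanSpace ℝ (Fin 3)), d⟫]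
  have hzn : 0 < ‖z‖ := norm_pos_iff.2 hz
  rw [fderiv3_newtonKernel_dde hz hde]
  have hneg : 15 * ⟪z, d⟫ ^ 2 - 3 * ‖z‖ ^ 2 * ‖d‖ ^ 2 < 0 := by linarith
  have hnum : ⟪z, e⟫ * (15 * ⟪z, d⟫ ^ 2 - 3 * ‖z‖ ^ 2 * ‖d‖ ^ 2) < 0 := mul_neg_of_pos_of_neg hze hneg
  have hden : 0 < 4 * π * ‖z‖ ^ 7 := by positivity
  exact div_neg_of_neg_of_pos hnum hden

/-- **The cone condition from an angular bound**: if `‖z − ⟨z,e⟩e‖ ≤ η‖z‖` (for a unit vector `e`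
this is the component of `z` orthogonal to `e`) with `η² < 1/5`, then `5⟨z, d⟩² < |z|²|d|²` for every
non-zero `d ⊥ e` and `z ≠ 0` (for `d ⊥ e`, `⟨z, d⟩ = ⟨z − ⟨z,e⟩e, d⟩`). [folklore] -/
theorem cone_of_orthogonal_component_le {z d e : EuclideanSpace ℝ (Fin 3)} {η : ℝ}
    (hde : ⟪d, e⟫ = 0) (hd : d ≠ 0) (hz : z ≠ 0) (hη : 5 * η ^ 2 < 1)
    (hcomp : ‖z - ⟪z, e⟫ • e‖ ≤ η * ‖z‖) : 5 * ⟪z, d⟫ ^ 2 < ‖z‖ ^ 2 * ‖d‖ ^ 2 := by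
  have hzd : ⟪z, d⟫ = ⟪z - ⟪z, e⟫ • e, d⟫ := by
    rw [inner_sub_left, real_inner_smul_left, real_inner_comm d e, hde, mul_zero, sub_zero]
  have hcs : |⟪z - ⟪z, e⟫ • e, d⟫| ≤ ‖z - ⟪z, e⟫ • e‖ * ‖d‖ := abs_real_inner_le_norm _ _
  have hdn : 0 < ‖d‖ := norm_pos_iff.2 hd
  have hzn : 0 < ‖z‖ := norm_pos_iff.2 hz
  have h1 : |⟪z, d⟫| ≤ η * ‖z‖ * ‖d‖ := by
    rw [hzd]
    exact hcs.trans (mul_le_mul_of_nonneg_right hcomp hdn.le)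
  have hη0 : 0 ≤ η := by
    have : 0 ≤ η * ‖z‖ := le_trans (norm_nonneg _) hcomp
    nlinarith
  have h2 : ⟪z, d⟫ ^ 2 ≤ (η * ‖z‖ * ‖d‖) ^ 2 := by
    rw [← sq_abs]
    exact pow_le_pow_left₀ (abs_nonneg _) h1 2
  have h3 : 0 < ‖z‖ ^ 2 * ‖d‖ ^ 2 := by positivity
  nlinarith

end Summit.NavierStokesRegularity.FluidComputer.PalasekTowerClayBridge.Germ

end
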